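import Literature.Geometry.Kaehler.ComplexTorusTotalLieAlgebraRatGrading
import HarnessLib

/-!
# `𝔤_tot(X; ℚ)₂ = e(H²(X; ℚ)) ≅ H²(X; ℚ)`: the abelian part of the Lefschetz triple `(𝔤_tot(X), h, H²(X))` on the
# rational points, and Looijenga–Lunts (2.8) "`𝔤² ⊗ M_{-n} → M_{-n+2}` is an isomorphism" over `ℚ`
# (Looijenga–Lunts 1997, §1 (1.1), (1.9), §2 (2.8), §3 (3.3), §6)

Layer `Literature/Geometry/Kaehler`, namespace `Literature.Geometry.Kaehler.ComplexTorus`; lane `lit-hodgefound` (Track 2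
foundations library, Layer A: Hodge theory of complex tori on invariant forms), skeleton seat `lit-hodgefound-skel-1`
(generation 37), row **A1-80** of `run/shared/lean/pub/lit-hodgefound/SKELETON.md`.  A sequel BY NAME (nothing restated) of
rows A1-57 (`ComplexTorusJordanLefschetzModules` §11: the REAL/complex version — `exists_eq_lefschetzG_of_lie_countingG`
"`𝔤²_tot = {e_κ}`", `lefschetzG_of_zero_oneForm₀` "`e_κ(1) = κ`", `eq_zero_of_apply_oneForm₀_add_I_smul_eq_zero` /
`exists_apply_oneForm₀_add_I_smul_eq` "`𝔤² ⊗ M_{-n} ≅ M_{-n+2}` over `ℝ·1 ⊕ ℝ·i·1`"), A1-60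
(`ComplexTorusNeronSeveriLieAlgebraDefinedOverQ`: `rationalEnd Φ = 𝔤𝔩(H•(X; ℚ))`, `lefschetzG_mem_rationalEnd`), A1-71
(`ComplexTorusTotalLieAlgebraDefinedOverQ`: `𝔤_tot(X; ℚ) = totalLieAlgebraRat Φ`, the lattice coordinates `dxᵢ = latticeDx Φ i`),
A1-75 (`ComplexTorusTotalLieAlgebraRatGrading`: the graded piece `𝔤_tot(X; ℚ)₂ = totalLieAlgebraRatDeg Φ 2` and, for `g ≥ 2`,
`𝔤_tot(X; ℚ)₂ = span_ℚ {e_{dxᵢ}e_{dxⱼ}}`, `dim = C(2g, 2)`) and of the `H•(X; ℚ)`-rows A4-3/A4-24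
(`ComplexTorusHodgeClasses`: `rationalForms Φ k = Hᵏ(X; ℚ)`, `ofRealForm`, `reForm`; `ComplexTorusRationalFormsBasis`:
`Hᵏ(X; ℚ) = span_ℚ` of the lattice monomials `latMonomial Φ k w`, `dim_ℚ Hᵏ(X; ℚ) = C(2g, k)`).
One definition (the `ℚ`-linear isomorphism `degTwoEquivRationalForms`), otherwise theorems; no instance, no local instance
attribute, no named fact, no `sorry` (D-0026 net debt `0`).

## Sources, VERBATIM

E. Looijenga, V. A. Lunts, *A Lie algebra attached to a projective variety*, Invent. Math. **129** (1997) 361–412 (held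
text `paper:arxiv-alg-geom_9604014`; page/line numbers of that text):

> (§1, Lefschetz triples, p0007 L55–L82) "suppose that conversely, we are given a semisimple Lie algebra `𝔤`, a simple
> element `h ∈ 𝔤` […] and an abelian subalgebra `𝔞` of `𝔤` such that (i) the adjoint representation of `𝔤` makes `𝔤` a
> Lefschetz module over `𝔞`, i.e., there is a rational map `f : 𝔞 → 𝔤₋₂` so that for `e` in the domain of `f`, we have an
> `𝔰𝔩(2)`-triple `(e, h, f_e)` and (ii) `𝔤` is as a Lie algebra generated by `𝔞` and the image of `f`. […] We shall call
> such a triple a Lefschetz triple […]. If we are given a Lefschetz pair `(𝔤, h)`, then we say that an associated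
> Lefschetz triple `(𝔤, h, 𝔞)` is **saturated if `𝔞` is maximal** for this property."
> (§1 (1.9), p0006 L119–L122) "If one of these Lie algebra's `𝔤_*(X)` is defined over a subfield `K ⊂ ℂ`, then we often
> write `𝔤_*(X; K)` for the corresponding Lie algebra of `K`-points."
> (§2 **(2.8) Lemma**, p0010 L61–L77) "Let `M` be an irreducible representation `M` of the Jordan–Lefschetz pair `(𝔤, h)`
> and let `n` be its depth as a Lefschetz module. Then `M` is a Jordan–Lefschetz module if and only if `dim M_{-n} = 1`.
> **If these equivalent conditions are fulfilled, then the natural map `𝔤² ⊗ M_{-n} → M_{-n+2}` is an isomorphism.**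
> Proof […] The fact that `𝔤₋₂ + 𝔤₀` is the `𝔤`-stabilizer of `M_{-n}` implies that `𝔤² ⊗ M_{-n} → M_{-n+2}` is injective.
> Since `M` is as a `U𝔤₂`-module generated by `M_{-n}`, it is also surjective."
> (§3 **(3.3) Proposition**, p0013 L110–L115) "There is a natural identification `(𝔤_tot(X; ℝ), h) ≅ (𝔰𝔬(V^* ⊕ V), u)`
> […]. Furthermore, `H^ev(X)[n]` is a semispinorial representation of `𝔤_tot(X; ℝ)` and **a fundamental Jordan–Lefschetz
> module of `H²(X, ℝ)`**."
> (§6, Frobenius–Lefschetz modules, p0023 L10–L20) "We say that a Lefschetz module `(M, 𝔞)` of depth `n` is Frobenius if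
> […] (1) `Prim M_{-n}` is of dimension one […], **(2) the map `𝔞 ⊗ M_{-n} → M_{-n+2}` is an isomorphism**, (3) `M` is
> generated as a `U𝔞`-module by `M_{-n}`. […] We also note that a Jordan–Lefschetz module is Frobenius."

H. Lange, *Abelian Varieties over the Complex Numbers* (Springer, 2023), §1.1.3 Cor. 1.1.19 / Exercise 1.1.6 (8)
(`Hᵏ(X, ℤ) = Altᵏ(Λ, ℤ)`, `Hᵏ(X, ℂ) = Hᵏ(X, ℤ) ⊗ ℂ`, `dim Hᵏ = C(2g, k)`) and §1.1.4 Prop. 1.1.20 (`∫_{λᵢ} dxⱼ = δᵢⱼ`) —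
the `H•(X; ℚ) = rationalForms` dictionary of rows A4-3/A4-24, used by name.

## Dictionary

`X = E/Φ(ℤ^ι)` (`g = dim_ℂ E`, `|ι| = 2g`), `H•(X; ℂ) = GForm E ℂ`, `1 = GForm.of 0 (oneForm₀ E) ∈ H⁰(X)` (the generator of
the lowest piece `M_{-n}` of `M = H^{ev}(X)[n]`), `Hᵏ(X; ℚ) = rationalForms Φ k` (complex-valued invariant `k`-forms with
rational periods on the lattice), `H•(X; ℚ) = rationalFormsG Φ`; the Lefschetz operator `e_η = lefschetzG η` of a REAL
`2`-form `η` (`= ρψ₂(η)`, cup product with `η`), `𝔤_tot(X; ℚ) = totalLieAlgebraRat Φ` (`= 𝔤_tot(X; ℝ) ∩ 𝔤𝔩(H•(X; ℚ))`),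
`𝔤_tot(X; ℚ)₂ = totalLieAlgebraRatDeg Φ 2` (`[h, T] = 2T`).  A real `2`-form `η` "is rational", `η ∈ H²(X; ℚ) ∩ H²(X; ℝ)`, when
`ofRealForm η ∈ rationalForms Φ 2`; conversely every `γ ∈ H²(X; ℚ)` is real-valued, `γ = ofRealForm (reForm γ)` (row A4-3's
`ofRealForm_reForm_of_mem_rationalForms_two`), so `H²(X; ℚ) ∋ γ ↦ reForm γ` identifies `rationalForms Φ 2` with the rational
real `2`-forms.

## What is formalised (theorems; one `def`)

* §1 `dxᵢ ∧ dxⱼ ∈ H²(X; ℤ) ⊂ H²(X; ℚ)`: `pairForm_latticeDx_apply_latticeVec` (`(dxᵢ ∧ dxⱼ)(λ_m, λ_n) = mᵢnⱼ - nᵢmⱼ`),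
  `ofRealForm_pairForm_latticeDx_mem_integralForms` / `…_mem_rationalForms`, `latMonomial_two_eq_ofRealForm_pairForm` /
  `ofRealForm_pairForm_latticeDx_eq_latMonomial` (the real pair form `dxᵢ ∧ dxⱼ` IS the lattice monomial
  `latMonomial Φ 2 ![i, j]` of row A4-24), and `rationalForms_two_eq_span_pairForm` (`H²(X; ℚ) = span_ℚ {dxᵢ ∧ dxⱼ}`).
* §2 `e` on the rational classes (every complex torus): `lefschetzG_mem_totalLieAlgebraRat'` (row A1-71's lemma WITHOUT its
  non-degeneracy hypothesis), **`lefschetzG_mem_totalLieAlgebraRatDeg_two` — `e_η ∈ 𝔤_tot(X; ℚ)₂` for every rational real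
  `2`-form `η`** (nondegenerate or not), `lefschetzG_apply_oneForm₀_two` (`e_η(1)₂ = η`), `apply_oneForm₀_mem_rationalForms`
  (`T(1) ∈ H•(X; ℚ)` for `T ∈ 𝔤_tot(X; ℚ)`).
* §3 **`eq_lefschetzG_reForm_of_mem_totalLieAlgebraRatDeg_two` / `mem_totalLieAlgebraRatDeg_two_iff_exists_lefschetzG` —
  `𝔤_tot(X; ℚ)₂ = {e_η : η ∈ H²(X; ℚ) real} = e(H²(X; ℚ))`** (every complex torus, `g ≥ 1`): an element `T` of `𝔤_tot(X; ℚ)₂` is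
  `e_κ` (row A1-57) and `κ = T(1)₂ ∈ H²(X; ℚ)` since `T` is a rational operator and `1 ∈ H⁰(X; ℚ)`;
  `coe_totalLieAlgebraRatDeg_two_eq_image`; **`lie_eq_zero_of_mem_totalLieAlgebraRatDeg_two'` — `𝔞 = 𝔤_tot(X; ℚ)₂` is
  ABELIAN** for every torus (row A1-75 assumed `g ≥ 2`).
* §4 **(2.8) ON THE RATIONAL POINTS — `degTwoEquivRationalForms Φ : 𝔤_tot(X; ℚ)₂ ≃ₗ[ℚ] H²(X; ℚ)`, `T ↦ T(1)`, with inverse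
  `γ ↦ e_{Re γ}`**: the natural map `𝔤₂ ⊗ M_{-n} → M_{-n+2}` (`M_{-n}(ℚ) = H⁰(X; ℚ) = ℚ·1`, row A4's `rationalForms_zero_eq_span`)
  is an isomorphism over `ℚ` — injective (`eq_of_apply_oneForm₀_eq`: an element of `𝔤₂(ℚ)` is determined by its value on
  `1`, "`𝔤₋₂ + 𝔤₀` is the stabilizer of `M_{-n}`") and surjective (`lefschetzG_reForm_apply_oneForm₀`: `γ = e_{Re γ}(1)`,
  `lefschetzG_reForm_mem_totalLieAlgebraRatDeg_two`); `apply_oneForm₀_eq_of_two` (`T(1)` is homogeneous of degree `2`);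
  consequently
  **`finrank_totalLieAlgebraRatDeg_two_eq_choose` — `dim_ℚ 𝔤_tot(X; ℚ)₂ = dim_ℚ H²(X; ℚ) = C(2g, 2)` for EVERY complex torus**
  (row A1-75 proved `C(2g, 2)` for `g ≥ 2` through `ψ₂ : ⋀²V_ℚ^* ≅ 𝔰𝔬_{2g}(ℚ)`; the present route through `H²` also covers
  `g = 1`, where `𝔤_tot(X; ℚ) ≅ 𝔰𝔩₂(ℚ)` and `dim 𝔤₂ = 1`).
* §5 THE TWO BASES MATCH: `degTwoEquivRationalForms_extR_mul_extR` (`e_{dxᵢ}e_{dxⱼ} ↦ dxᵢ ∧ dxⱼ = latMonomial Φ 2 ![i, j]`),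
  and **`totalLieAlgebraRatDeg_two_eq_span_extR_mul_extR` — `𝔤_tot(X; ℚ)₂ = span_ℚ {e_{dxᵢ}e_{dxⱼ}}` for every complex torus**
  (row A1-75's `totalLieAlgebraRatDeg_two_eq_span` without its hypothesis `g ≥ 2`, now via `H²(X; ℚ) = span_ℚ {dxᵢ ∧ dxⱼ}`).
* §6 VALIDATION (Layer-A referee): an abelian surface (`dim_ℚ 𝔤₂(ℚ) = 6 = dim_ℚ H²(X; ℚ)`) and an ELLIPTIC CURVE
  (`dim_ℚ 𝔤_tot(X; ℚ)₂ = 1 = dim_ℚ H²(X; ℚ)`, the case outside row A1-75).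

## SCOPE (what is NOT claimed)

(a) The tensor product `𝔤₂ ⊗ M_{-n}` is not formed: since `M_{-n}(ℚ) = H⁰(X; ℚ) = ℚ·1` is a line, "(2.8): `𝔤² ⊗ M_{-n} →
M_{-n+2}` is an isomorphism" is rendered as the bijectivity (a `LinearEquiv`) of evaluation at `1`, `𝔤_tot(X; ℚ)₂ → H²(X; ℚ)`;
the real/complex version is row A1-57's.  (b) Only the abelian part `𝔞 = 𝔤₂ ≅ H²` of the Lefschetz triple
`(𝔤_tot(X; ℚ), h, H²(X; ℚ))` is treated: that `e(H²(X; ℚ)) = 𝔤_tot(X; ℚ)₂` is abelian and that `𝔤_tot(X; ℚ)` is generated by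
`𝔤₂(ℚ) ∪ 𝔤₋₂(ℚ)` are rows A1-75/A1-79 (`lie_relations_totalLieAlgebraRatDeg`, `mem_totalLieAlgebraRat_iff_forall_lie_closed`,
not imported here); the partial map `f : η ↦ f_η ∈ 𝔤₋₂(ℚ)` on NONDEGENERATE rational `η` is in the tree only for `η` of type
`(1,1)` (row A1-60's `lefschetzDualG_mem_rationalEnd_of_isNSForm`) — its extension to rational nondegenerate `η` of any type,
and hence "saturated", are NOT proved here.  (c) The abstract notions Lefschetz triple / Jordan–Lefschetz / Frobenius module
are not defined; only the displayed clauses are proved for `𝔤_tot(X; ℚ)` acting on `H•(X; ℚ)`.  (d) Nothing about `𝔤_NS`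
(row A1-69 has `NS_ℚ(X) ≅ 𝔤_NS(X; ℚ)₂`), `𝔤_K`, `𝔤_MT`.  (e) Nothing in this file is a case of the Hodge conjecture.

## References

* [LooijengaLunts1997] E. Looijenga, V. A. Lunts, *A Lie algebra attached to a projective variety*, Invent. Math. 129 (1997)
  361–412; arXiv:alg-geom/9604014. §1 (1.1) (Lefschetz triples), (1.9); §2 (2.8); §3 (3.3); §6 (held
  `paper:arxiv-alg-geom_9604014`, p0006–p0007, p0010, p0013, p0023).
* [Lange2023AbelianVarietiesComplex] H. Lange, *Abelian Varieties over the Complex Numbers*, Grundlehren Text Editions,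
  Springer (2023), §1.1.3 Cor. 1.1.19, Exercise 1.1.6 (8), §1.1.4 Prop. 1.1.20.
* [Voisin2002] C. Voisin, *Hodge Theory and Complex Algebraic Geometry I*, Cambridge (2002), §6.2, §7.1.2 (the Lefschetz
  operator of a rational class acts on rational cohomology).
-/

noncomputable section

-- `Module ℚ` / `Module ℂ` synthesis on `E [⋀^Fin k]→L[ℝ] ℂ`, as in the parent files
set_option maxSynthPendingDepth 3

open Module Function
open Literature.LinearAlgebra.Alternating
open Literature.LinearAlgebra.Alternating.GForm (of extR of_apply_self of_injective)
open Literature.Analysis.Complex (oneForm₀)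

namespace Literature.Geometry.Kaehler

namespace ComplexTorus

/-! ### §1 The rational real `2`-forms `dxᵢ ∧ dxⱼ ∈ H²(X; ℤ) ⊂ H²(X; ℚ)` -/

section RationalTwoForms

variable {ι : Type*} {E : Type*} [NormedAddCommGroup E] [NormedSpace ℂ E] (Φ : (ι → ℝ) ≃L[ℝ] E)

/-- A `2`-form is determined by its values on the literal pairs `![u, v]`. [folklore] -/
private theorem twoForm_apply_eq_vecCons {F : Type*} [NormedAddCommGroup F] [NormedSpace ℝ F]
    (γ : E [⋀^Fin 2]→L[ℝ] F) (v : Fin 2 → E) : γ v = γ ![v 0, v 1] := by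
  congr 1; funext i; fin_cases i <;> rfl

/-- **`(dxᵢ ∧ dxⱼ)(λ_m, λ_n) = mᵢ nⱼ - nᵢ mⱼ`** on lattice vectors `λ_m = Φ(m)`, `λ_n = Φ(n)` (`∫_{λ_a} dx_b = δ_{ab}`).
[cite: Lange2023AbelianVarietiesComplex, §1.1.4 Prop. 1.1.20] -/
theorem pairForm_latticeDx_apply_latticeVec (i j : ι) (m n : ι → ℤ) :
    pairForm (latticeDx Φ i) (latticeDx Φ j) ![latticeVec Φ m, latticeVec Φ n] = m i * n j - n i * m j := by
  rw [pairForm_apply, latticeDx_latticeVec, latticeDx_latticeVec, latticeDx_latticeVec, latticeDx_latticeVec]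

/-- **`dxᵢ ∧ dxⱼ ∈ H²(X; ℤ)`**: the pair form of two lattice coordinates has integral periods.
[cite: Lange2023AbelianVarietiesComplex, §1.1.3 Lemma 1.1.17 and Cor. 1.1.19] -/
theorem ofRealForm_pairForm_latticeDx_mem_integralForms (i j : ι) :
    ofRealForm (pairForm (latticeDx Φ i) (latticeDx Φ j)) ∈ integralForms Φ 2 := fun m ↦
  ⟨m 0 i * m 1 j - m 1 i * m 0 j, by
    rw [twoForm_apply_eq_vecCons, ofRealForm_apply, latticeTuple_apply, latticeTuple_apply,
      pairForm_latticeDx_apply_latticeVec]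
    push_cast; ring⟩

/-- **`dxᵢ ∧ dxⱼ ∈ H²(X; ℚ)`** (a rational real `2`-form). [cite: Lange2023AbelianVarietiesComplex, §1.1.3 Cor. 1.1.19] -/
theorem ofRealForm_pairForm_latticeDx_mem_rationalForms (i j : ι) :
    ofRealForm (pairForm (latticeDx Φ i) (latticeDx Φ j)) ∈ rationalForms Φ 2 :=
  mem_rationalForms_of_mem_integralForms Φ (ofRealForm_pairForm_latticeDx_mem_integralForms Φ i j)

/-- **The lattice monomial `latMonomial Φ 2 w` of row A4-24 IS the real pair form `dx_{w 0} ∧ dx_{w 1}`** (both evaluate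
to `dx_{w 0}(u)dx_{w 1}(v) - dx_{w 0}(v)dx_{w 1}(u)`, a `2 × 2` determinant). [cite: Lange2023AbelianVarietiesComplex, §1.1.3 Cor. 1.1.19 and Exercise 1.1.6 (8)] -/
theorem latMonomial_two_eq_ofRealForm_pairForm (w : Fin 2 → ι) :
    latMonomial Φ 2 w = ofRealForm (pairForm (latticeDx Φ (w 0)) (latticeDx Φ (w 1))) := by
  ext v
  rw [twoForm_apply_eq_vecCons (latMonomial Φ 2 w) v, twoForm_apply_eq_vecCons (ofRealForm _) v, ofRealForm_apply,
    pairForm_apply, latMonomial_eq, wedgeWord_apply, Matrix.det_fin_two]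
  simp only [pairingMatrix_apply, ContinuousLinearMap.smulRight_apply, coord_apply, latticeDx_apply,
    Matrix.cons_val_zero, Matrix.cons_val_one, ContinuousAlternatingMap.constOfIsEmpty_apply, Complex.real_smul, mul_one]
  push_cast; ring

/-- **The real pair form `dxᵢ ∧ dxⱼ` IS the lattice monomial `latMonomial Φ 2 ![i, j]`.**
[cite: Lange2023AbelianVarietiesComplex, §1.1.3 Cor. 1.1.19 and Exercise 1.1.6 (8)] -/
theorem ofRealForm_pairForm_latticeDx_eq_latMonomial (i j : ι) :
    ofRealForm (pairForm (latticeDx Φ i) (latticeDx Φ j)) = latMonomial Φ 2 ![i, j] :=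
  (latMonomial_two_eq_ofRealForm_pairForm Φ ![i, j]).symm

/-- `Re (dxᵢ ∧ dxⱼ) = dxᵢ ∧ dxⱼ` (the lattice monomial is real). [cite: Lange2023AbelianVarietiesComplex, §1.1.3 Cor. 1.1.19] -/
theorem reForm_latMonomial_two (i j : ι) :
    reForm (latMonomial Φ 2 ![i, j]) = pairForm (latticeDx Φ i) (latticeDx Φ j) := by
  rw [← ofRealForm_pairForm_latticeDx_eq_latMonomial, reForm_ofRealForm]

/-- **`H²(X; ℚ) = span_ℚ {dxᵢ ∧ dxⱼ}`** (all pairs `(i, j)`; row A4-24's monomial basis indexed by increasing words).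
[cite: Lange2023AbelianVarietiesComplex, §1.1.3 Cor. 1.1.19 and Exercise 1.1.6 (8)] -/
theorem rationalForms_two_eq_span_pairForm [Fintype ι] [DecidableEq ι] :
    rationalForms Φ 2 = Submodule.span ℚ
      {γ : E [⋀^Fin 2]→L[ℝ] ℂ | ∃ i j : ι, γ = ofRealForm (pairForm (latticeDx Φ i) (latticeDx Φ j))} := by
  letI : LinearOrder ι := LinearOrder.lift' (Fintype.equivFin ι) (Fintype.equivFin ι).injective
  refine le_antisymm ?_ (Submodule.span_le.2 ?_)
  · rw [rationalForms_eq_span_latMonomial Φ 2]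
    refine Submodule.span_mono ?_
    rintro _ ⟨w, rfl⟩
    exact ⟨w.1 0, w.1 1, latMonomial_two_eq_ofRealForm_pairForm Φ w.1⟩
  · rintro _ ⟨i, j, rfl⟩
    exact ofRealForm_pairForm_latticeDx_mem_rationalForms Φ i j

/-- `Re (q γ) = q Re γ` for a rational scalar (`Re` is additive: row A4's `reForm_add`). [cite: Lange2023AbelianVarietiesComplex, §1.1.3 Cor. 1.1.19] -/
theorem reForm_rat_smul {k : ℕ} (q : ℚ) (γ : E [⋀^Fin k]→L[ℝ] ℂ) : reForm (q • γ) = (q : ℝ) • reForm γ := by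
  ext v
  rw [reForm_apply, ContinuousAlternatingMap.smul_apply, ContinuousAlternatingMap.smul_apply, reForm_apply, Rat.smul_def,
    ← Complex.ofReal_ratCast, Complex.re_ofReal_mul, smul_eq_mul]

end RationalTwoForms

/-! ### §2 The Lefschetz operators of the rational classes lie in `𝔤_tot(X; ℚ)₂` (every complex torus) -/

section LefschetzRat

variable {ι : Type*} {E : Type*} [NormedAddCommGroup E] [NormedSpace ℂ E] [FiniteDimensional ℂ E]
  (Φ : (ι → ℝ) ≃L[ℝ] E)

omit [FiniteDimensional ℂ E] in
/-- `(2 : ℝ) • T = 2 • T` (the `ad h`-degree `2` condition of `totalLieAlgebraRatDeg Φ 2` against the `ℕ`-scalar form of the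
tree's `lie_countingG_lefschetzG`). [folklore] -/
private theorem two_real_smul_eq (T : Module.End ℂ (GForm E ℂ)) : (2 : ℝ) • T = 2 • T := by
  rw [two_smul, two_smul]

/-- `e_{η + θ} = e_η + e_θ` (through `ρψ₂`, row A1-43's `upEndₗ`; re-derived as in row A1-69 to keep the import closure
small). [cite: LooijengaLunts1997, §3 (3.2)] -/
private theorem lefschetzG_add_aux (η θ : E [⋀^Fin 2]→L[ℝ] ℝ) : lefschetzG (η + θ) = lefschetzG η + lefschetzG θ := by
  simp only [← spinorRepLin_upEnd, ← upEndₗ_apply, map_add]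

/-- **`e_κ(1)₂ = κ`**: the degree-`2` component of `e_κ(1)`, `1 ∈ H⁰(X)`, is the class `κ ∈ H²(X; ℂ)` (row A1-57's
`lefschetzG_of_zero_oneForm₀`). [cite: LooijengaLunts1997, §2 (2.8)] -/
theorem lefschetzG_apply_oneForm₀_two (κ : E [⋀^Fin 2]→L[ℝ] ℝ) :
    lefschetzG κ (of 0 (oneForm₀ E)) 2 = ofRealForm κ := by
  rw [lefschetzG_of_zero_oneForm₀, of_apply_self]

/-- **`κ ↦ e_κ` is injective on the real `2`-forms** — read off from `e_κ(1)₂ = κ`. [cite: LooijengaLunts1997, §1 (1.1), §2 (2.8)] -/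
theorem eq_of_lefschetzG_eq {κ κ' : E [⋀^Fin 2]→L[ℝ] ℝ} (h : lefschetzG κ = lefschetzG κ') : κ = κ' :=
  ofRealForm_injective (by rw [← lefschetzG_apply_oneForm₀_two κ, ← lefschetzG_apply_oneForm₀_two κ', h])

omit [FiniteDimensional ℂ E] in
/-- `1 ∈ H⁰(X; ℚ) ⊂ H•(X; ℚ)`. [cite: Lange2023AbelianVarietiesComplex, §1.1.3 Cor. 1.1.19] -/
theorem of_zero_oneForm₀_mem_rationalFormsG : of 0 (oneForm₀ E) ∈ rationalFormsG Φ :=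
  of_mem_rationalFormsG Φ (mem_rationalForms_of_mem_integralForms Φ (oneForm₀_mem_integralForms Φ))

omit [FiniteDimensional ℂ E] in
/-- **An element of `𝔤_tot(X; ℚ)` maps `1 ∈ H⁰(X; ℚ)` into `H•(X; ℚ)`**: every component `T(1)_m ∈ Hᵐ(X; ℚ)` (`𝔤_tot(X; ℚ) ⊆
𝔤𝔩(H•(X; ℚ))`, row A1-60/A1-71). [cite: LooijengaLunts1997, §1 (1.7), (1.9)] -/
theorem apply_oneForm₀_mem_rationalForms {T : Module.End ℂ (GForm E ℂ)} (hT : T ∈ totalLieAlgebraRat Φ) (m : ℕ) :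
    T (of 0 (oneForm₀ E)) m ∈ rationalForms Φ m :=
  (mem_rationalFormsG_iff Φ).1
    ((mem_rationalEnd_iff Φ).1 (mem_rationalEnd_of_mem_totalLieAlgebraRat Φ hT) _ (of_zero_oneForm₀_mem_rationalFormsG Φ)) m

variable [Nontrivial E]

/-- **`e_η ∈ 𝔤_tot(X; ℚ)` for EVERY rational real `2`-form `η`** — row A1-71's `lefschetzG_mem_totalLieAlgebraRat` without its
non-degeneracy hypothesis (`e_η ∈ 𝔤_tot(X; ℝ)` for every real `η`, row A1-57's `lefschetzG_mem_totalLieAlgebra'`, and `e_η` is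
a rational operator when `η ∈ H²(X; ℚ)`, row A1-60). [cite: LooijengaLunts1997, §1 (1.1), (1.7), (1.9)] -/
theorem lefschetzG_mem_totalLieAlgebraRat' {η : E [⋀^Fin 2]→L[ℝ] ℝ} (hη : ofRealForm η ∈ rationalForms Φ 2) :
    lefschetzG η ∈ totalLieAlgebraRat Φ :=
  (mem_totalLieAlgebraRat_iff Φ).2 ⟨lefschetzG_mem_totalLieAlgebra' η, lefschetzG_mem_rationalEnd Φ hη⟩

/-- **`e_η ∈ 𝔤_tot(X; ℚ)₂` for every rational real `2`-form `η`** (`[h, e_η] = 2e_η`): the abelian part `e(𝔞)`, `𝔞 = H²(X; ℚ)`,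
of the Lefschetz triple `(𝔤_tot(X; ℚ), h, H²(X; ℚ))` sits in degree `2` — for ALL rational `η`, degenerate ones included.
[cite: LooijengaLunts1997, §1 (1.1), §3 (3.3)] -/
theorem lefschetzG_mem_totalLieAlgebraRatDeg_two {η : E [⋀^Fin 2]→L[ℝ] ℝ} (hη : ofRealForm η ∈ rationalForms Φ 2) :
    lefschetzG η ∈ totalLieAlgebraRatDeg Φ 2 :=
  (mem_totalLieAlgebraRatDeg_iff Φ).2 ⟨lefschetzG_mem_totalLieAlgebraRat' Φ hη, by
    rw [lie_countingG_lefschetzG, two_real_smul_eq]⟩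

/-- **`e_{dxᵢ} e_{dxⱼ} = e_{dxᵢ ∧ dxⱼ} ∈ 𝔤_tot(X; ℚ)₂`** for every complex torus (row A1-75's
`extR_mul_extR_mem_totalLieAlgebraRatDeg_two` had it for `g ≥ 2`). [cite: LooijengaLunts1997, §3 (3.1)–(3.3)] -/
theorem extR_mul_extR_latticeDx_mem_totalLieAlgebraRatDeg_two (i j : ι) :
    extR (latticeDx Φ i) * extR (latticeDx Φ j) ∈ totalLieAlgebraRatDeg Φ 2 := by
  rw [extR_mul_extR_eq_lefschetzG_pairForm]
  exact lefschetzG_mem_totalLieAlgebraRatDeg_two Φ (ofRealForm_pairForm_latticeDx_mem_rationalForms Φ i j)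

/-! ### §3 `𝔤_tot(X; ℚ)₂ = e(H²(X; ℚ))`: every element of the degree-`2` piece is `e_η`, `η = T(1)₂ ∈ H²(X; ℚ)` -/

/-- **`T = e_{Re(T(1)₂)}` for `T ∈ 𝔤_tot(X; ℚ)₂`**: an element of the degree-`2` piece of `𝔤_tot(X; ℝ)` is a Lefschetz
operator `e_κ` (row A1-57's `exists_eq_lefschetzG_of_lie_countingG`, "`𝔤² = ψ₂(⋀²V^*)`"), and `κ = e_κ(1)₂ = T(1)₂`.
[cite: LooijengaLunts1997, §2 (2.8), §3 (3.1), (3.3)] -/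
theorem eq_lefschetzG_reForm_of_mem_totalLieAlgebraRatDeg_two {T : Module.End ℂ (GForm E ℂ)}
    (hT : T ∈ totalLieAlgebraRatDeg Φ 2) : T = lefschetzG (reForm (T (of 0 (oneForm₀ E)) 2)) := by
  obtain ⟨κ, rfl⟩ := exists_eq_lefschetzG_of_lie_countingG (mem_totalLieAlgebra_of_mem_totalLieAlgebraRat Φ hT.1)
    (by rw [((mem_totalLieAlgebraRatDeg_iff Φ).1 hT).2, two_real_smul_eq])
  rw [lefschetzG_apply_oneForm₀_two, reForm_ofRealForm]

/-- **`𝔤_tot(X; ℚ)₂ ⊆ e(H²(X; ℚ))`: every `T ∈ 𝔤_tot(X; ℚ)₂` is `e_η` for a RATIONAL real `2`-form `η`** (`η = T(1)₂` is rational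
because `T` preserves `H•(X; ℚ)` and `1 ∈ H⁰(X; ℚ)`). [cite: LooijengaLunts1997, §1 (1.9), §2 (2.8), §3 (3.3)] -/
theorem exists_eq_lefschetzG_of_mem_totalLieAlgebraRatDeg_two {T : Module.End ℂ (GForm E ℂ)}
    (hT : T ∈ totalLieAlgebraRatDeg Φ 2) :
    ∃ η : E [⋀^Fin 2]→L[ℝ] ℝ, ofRealForm η ∈ rationalForms Φ 2 ∧ T = lefschetzG η := by
  have h2 := apply_oneForm₀_mem_rationalForms Φ hT.1 2
  obtain ⟨κ, rfl⟩ := exists_eq_lefschetzG_of_lie_countingG (mem_totalLieAlgebra_of_mem_totalLieAlgebraRat Φ hT.1)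
    (by rw [((mem_totalLieAlgebraRatDeg_iff Φ).1 hT).2, two_real_smul_eq])
  rw [lefschetzG_apply_oneForm₀_two] at h2
  exact ⟨κ, h2, rfl⟩

/-- **`𝔤_tot(X; ℚ)₂ = {e_η : η a rational real 2-form}`** (every complex torus). [cite: LooijengaLunts1997, §1 (1.1), (1.9), §2 (2.8), §3 (3.3)] -/
theorem mem_totalLieAlgebraRatDeg_two_iff_exists_lefschetzG {T : Module.End ℂ (GForm E ℂ)} :
    T ∈ totalLieAlgebraRatDeg Φ 2 ↔ ∃ η : E [⋀^Fin 2]→L[ℝ] ℝ, ofRealForm η ∈ rationalForms Φ 2 ∧ T = lefschetzG η := by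
  refine ⟨exists_eq_lefschetzG_of_mem_totalLieAlgebraRatDeg_two Φ, ?_⟩
  rintro ⟨η, hη, rfl⟩
  exact lefschetzG_mem_totalLieAlgebraRatDeg_two Φ hη

/-- **`𝔤_tot(X; ℚ)₂ = e({η : η rational})` as sets of operators.** [cite: LooijengaLunts1997, §1 (1.1), §3 (3.3)] -/
theorem coe_totalLieAlgebraRatDeg_two_eq_image :
    (totalLieAlgebraRatDeg Φ 2 : Set (Module.End ℂ (GForm E ℂ))) =
      lefschetzG '' {η : E [⋀^Fin 2]→L[ℝ] ℝ | ofRealForm η ∈ rationalForms Φ 2} := by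
  ext T
  rw [SetLike.mem_coe, mem_totalLieAlgebraRatDeg_two_iff_exists_lefschetzG, Set.mem_image]
  constructor
  · rintro ⟨η, hη, rfl⟩; exact ⟨η, hη, rfl⟩
  · rintro ⟨η, hη, rfl⟩; exact ⟨η, hη, rfl⟩

/-- **`𝔤_tot(X; ℚ)₂ = e(H²(X; ℚ))` IS ABELIAN, `[S, T] = 0`, for EVERY complex torus** (the abelian subalgebra `𝔞` of the
Lefschetz triple; `[e_η, e_θ] = 0` since even classes commute under cup product — row A1-75's
`lie_eq_zero_of_mem_totalLieAlgebraRatDeg_two` assumed `g ≥ 2`). [cite: LooijengaLunts1997, §1 (1.1) ("an abelian subalgebra 𝔞 of 𝔤"), §2 (2.5) ("[e, 𝔤₂] = 0")] -/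
theorem lie_eq_zero_of_mem_totalLieAlgebraRatDeg_two' {S T : Module.End ℂ (GForm E ℂ)}
    (hS : S ∈ totalLieAlgebraRatDeg Φ 2) (hT : T ∈ totalLieAlgebraRatDeg Φ 2) : ⁅S, T⁆ = 0 := by
  obtain ⟨η, -, rfl⟩ := exists_eq_lefschetzG_of_mem_totalLieAlgebraRatDeg_two Φ hS
  obtain ⟨θ, -, rfl⟩ := exists_eq_lefschetzG_of_mem_totalLieAlgebraRatDeg_two Φ hT
  exact lie_lefschetzG_lefschetzG η θ

/-- **Injectivity of `𝔤₂ ⊗ M_{-n} → M_{-n+2}` over `ℚ`: an element of `𝔤_tot(X; ℚ)₂` is determined by its value on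
`1 ∈ H⁰(X)`** ("the fact that `𝔤₋₂ + 𝔤₀` is the `𝔤`-stabilizer of `M_{-n}` implies that `𝔤² ⊗ M_{-n} → M_{-n+2}` is
injective"). [cite: LooijengaLunts1997, §2 (2.8)] -/
theorem eq_of_apply_oneForm₀_eq {S T : Module.End ℂ (GForm E ℂ)} (hS : S ∈ totalLieAlgebraRatDeg Φ 2)
    (hT : T ∈ totalLieAlgebraRatDeg Φ 2) (h : S (of 0 (oneForm₀ E)) = T (of 0 (oneForm₀ E))) : S = T := by
  rw [eq_lefschetzG_reForm_of_mem_totalLieAlgebraRatDeg_two Φ hS, eq_lefschetzG_reForm_of_mem_totalLieAlgebraRatDeg_two Φ hT,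
    h]

/-- **`T(1)` is homogeneous of degree `2`** for `T ∈ 𝔤_tot(X; ℚ)₂`: `T(1) = T(1)₂ ∈ H²(X) = M_{-n+2}`.
[cite: LooijengaLunts1997, §2 (2.8)] -/
theorem apply_oneForm₀_eq_of_two {T : Module.End ℂ (GForm E ℂ)} (hT : T ∈ totalLieAlgebraRatDeg Φ 2) :
    T (of 0 (oneForm₀ E)) = of 2 (T (of 0 (oneForm₀ E)) 2) := by
  obtain ⟨η, -, rfl⟩ := exists_eq_lefschetzG_of_mem_totalLieAlgebraRatDeg_two Φ hT
  rw [lefschetzG_of_zero_oneForm₀, of_apply_self]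

/-! ### §4 (2.8) on the rational points: evaluation at `1 ∈ H⁰(X; ℚ)` is a `ℚ`-isomorphism `𝔤_tot(X; ℚ)₂ ≅ H²(X; ℚ)` -/

variable [Fintype ι]

/-- **`e_{Re γ} ∈ 𝔤_tot(X; ℚ)₂` for `γ ∈ H²(X; ℚ)`** (a rational class is real-valued: `γ = ofRealForm (reForm γ)`, row A4-3).
[cite: LooijengaLunts1997, §1 (1.1), §3 (3.3)] -/
theorem lefschetzG_reForm_mem_totalLieAlgebraRatDeg_two {γ : E [⋀^Fin 2]→L[ℝ] ℂ} (hγ : γ ∈ rationalForms Φ 2) :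
    lefschetzG (reForm γ) ∈ totalLieAlgebraRatDeg Φ 2 :=
  lefschetzG_mem_totalLieAlgebraRatDeg_two Φ (by rwa [ofRealForm_reForm_of_mem_rationalForms_two Φ hγ])

/-- **`𝔤_tot(X; ℚ)₂ = {e_{Re γ} : γ ∈ H²(X; ℚ)}`** (the statement of §3 indexed by `H²(X; ℚ) = rationalForms Φ 2`).
[cite: LooijengaLunts1997, §1 (1.1), (1.9), §2 (2.8), §3 (3.3)] -/
theorem mem_totalLieAlgebraRatDeg_two_iff_exists_reForm {T : Module.End ℂ (GForm E ℂ)} :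
    T ∈ totalLieAlgebraRatDeg Φ 2 ↔ ∃ γ ∈ rationalForms Φ 2, T = lefschetzG (reForm γ) := by
  refine ⟨fun hT ↦ ⟨T (of 0 (oneForm₀ E)) 2, apply_oneForm₀_mem_rationalForms Φ hT.1 2,
    eq_lefschetzG_reForm_of_mem_totalLieAlgebraRatDeg_two Φ hT⟩, ?_⟩
  rintro ⟨γ, hγ, rfl⟩
  exact lefschetzG_reForm_mem_totalLieAlgebraRatDeg_two Φ hγ

omit [Nontrivial E] in
/-- **Surjectivity of `𝔤₂ ⊗ M_{-n} → M_{-n+2} = H²(X; ℚ)` over `ℚ`: every `γ ∈ H²(X; ℚ)` is `e_{Re γ}(1)`** ("since `M` is as a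
`U𝔤₂`-module generated by `M_{-n}`, it is also surjective"). [cite: LooijengaLunts1997, §2 (2.8)] -/
theorem lefschetzG_reForm_apply_oneForm₀ {γ : E [⋀^Fin 2]→L[ℝ] ℂ} (hγ : γ ∈ rationalForms Φ 2) :
    lefschetzG (reForm γ) (of 0 (oneForm₀ E)) = of 2 γ := by
  rw [lefschetzG_of_zero_oneForm₀, ofRealForm_reForm_of_mem_rationalForms_two Φ hγ]

/-- **LOOIJENGA–LUNTS (2.8) ON THE RATIONAL POINTS: `𝔤_tot(X; ℚ)₂ ≅ H²(X; ℚ)`, `T ↦ T(1)`** — the natural map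
`𝔤₂ ⊗ M_{-n} → M_{-n+2}` of the Jordan–Lefschetz module `M = H^{ev}(X)[n]` (`M_{-n}(ℚ) = H⁰(X; ℚ) = ℚ·1`, `M_{-n+2}(ℚ) =
H²(X; ℚ)`) is an isomorphism of `ℚ`-vector spaces; its inverse is the Lefschetz map `γ ↦ e_{Re γ}` of the abelian part
`𝔞 = H²(X; ℚ)` of the Lefschetz triple `(𝔤_tot(X; ℚ), h, H²(X; ℚ))` ("a fundamental Jordan–Lefschetz module of `H²(X)`";
Frobenius property (2): "the map `𝔞 ⊗ M_{-n} → M_{-n+2}` is an isomorphism").  Every complex torus (`g ≥ 1`).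
[cite: LooijengaLunts1997, §1 (1.1), (1.9), §2 (2.8), §3 (3.3), §6] -/
def degTwoEquivRationalForms : totalLieAlgebraRatDeg Φ 2 ≃ₗ[ℚ] rationalForms Φ 2 where
  toFun T := ⟨(T : Module.End ℂ (GForm E ℂ)) (of 0 (oneForm₀ E)) 2, apply_oneForm₀_mem_rationalForms Φ T.2.1 2⟩
  map_add' _ _ := rfl
  map_smul' _ _ := rfl
  invFun γ := ⟨lefschetzG (reForm (γ : E [⋀^Fin 2]→L[ℝ] ℂ)), lefschetzG_reForm_mem_totalLieAlgebraRatDeg_two Φ γ.2⟩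
  left_inv T := Subtype.ext (eq_lefschetzG_reForm_of_mem_totalLieAlgebraRatDeg_two Φ T.2).symm
  right_inv γ := Subtype.ext (by
    change lefschetzG (reForm (γ : E [⋀^Fin 2]→L[ℝ] ℂ)) (of 0 (oneForm₀ E)) 2 = (γ : E [⋀^Fin 2]→L[ℝ] ℂ)
    rw [lefschetzG_apply_oneForm₀_two, ofRealForm_reForm_of_mem_rationalForms_two Φ γ.2])

/-- The isomorphism evaluates at `1`: `degTwoEquivRationalForms Φ T = T(1)₂`. [cite: LooijengaLunts1997, §2 (2.8)] -/
@[simp]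
theorem degTwoEquivRationalForms_apply_coe (T : totalLieAlgebraRatDeg Φ 2) :
    ((degTwoEquivRationalForms Φ T : rationalForms Φ 2) : E [⋀^Fin 2]→L[ℝ] ℂ) =
      (T : Module.End ℂ (GForm E ℂ)) (of 0 (oneForm₀ E)) 2 := rfl

/-- Its inverse is the Lefschetz map: `(degTwoEquivRationalForms Φ).symm γ = e_{Re γ}`. [cite: LooijengaLunts1997, §1 (1.1), §2 (2.8)] -/
@[simp]
theorem degTwoEquivRationalForms_symm_apply_coe (γ : rationalForms Φ 2) :
    (((degTwoEquivRationalForms Φ).symm γ : totalLieAlgebraRatDeg Φ 2) : Module.End ℂ (GForm E ℂ)) =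
      lefschetzG (reForm (γ : E [⋀^Fin 2]→L[ℝ] ℂ)) := rfl

/-- `T(1) = of 2 (degTwoEquivRationalForms Φ T)`: the whole value `T(1) ∈ H•(X)` is the class in `H²(X; ℚ)`.
[cite: LooijengaLunts1997, §2 (2.8)] -/
theorem of_two_degTwoEquivRationalForms (T : totalLieAlgebraRatDeg Φ 2) :
    of 2 ((degTwoEquivRationalForms Φ T : rationalForms Φ 2) : E [⋀^Fin 2]→L[ℝ] ℂ) =
      (T : Module.End ℂ (GForm E ℂ)) (of 0 (oneForm₀ E)) :=
  (apply_oneForm₀_eq_of_two Φ T.2).symm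

/-- `degTwoEquivRationalForms Φ e_η = η` for a rational real `2`-form `η`. [cite: LooijengaLunts1997, §1 (1.1), §2 (2.8)] -/
theorem degTwoEquivRationalForms_lefschetzG {η : E [⋀^Fin 2]→L[ℝ] ℝ} (hη : ofRealForm η ∈ rationalForms Φ 2) :
    degTwoEquivRationalForms Φ ⟨lefschetzG η, lefschetzG_mem_totalLieAlgebraRatDeg_two Φ hη⟩ = ⟨ofRealForm η, hη⟩ :=
  Subtype.ext (lefschetzG_apply_oneForm₀_two η)

/-- **`dim_ℚ 𝔤_tot(X; ℚ)₂ = dim_ℚ H²(X; ℚ)`** (every complex torus). [cite: LooijengaLunts1997, §2 (2.8), §3 (3.3)] -/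
theorem finrank_totalLieAlgebraRatDeg_two_eq_finrank_rationalForms :
    finrank ℚ (totalLieAlgebraRatDeg Φ 2) = finrank ℚ (rationalForms Φ 2) :=
  (degTwoEquivRationalForms Φ).finrank_eq

/-- **`dim_ℚ 𝔤_tot(X; ℚ)₂ = C(2g, 2)` FOR EVERY COMPLEX TORUS** (`= dim_ℚ H²(X; ℚ)`, Lange's `dim Hᵏ = C(2g, k)`; row A1-75's
`finrank_totalLieAlgebraRatDeg_two` gave it for `g ≥ 2` through `𝔰𝔬_{2g}(ℚ)`, the present route also covers `g = 1`).
[cite: LooijengaLunts1997, §2 (2.8), §3 (3.3)] [cite: Lange2023AbelianVarietiesComplex, §1.1.3 Exercise 1.1.6 (8)] -/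
theorem finrank_totalLieAlgebraRatDeg_two_eq_choose :
    finrank ℚ (totalLieAlgebraRatDeg Φ 2) = (2 * finrank ℂ E).choose 2 := by
  rw [finrank_totalLieAlgebraRatDeg_two_eq_finrank_rationalForms, finrank_rationalForms_eq_choose Φ 2,
    card_eq_two_mul_finrank Φ]

/-! ### §5 The two bases match: `e_{dxᵢ}e_{dxⱼ} ↦ dxᵢ ∧ dxⱼ`, and `𝔤_tot(X; ℚ)₂ = span_ℚ {e_{dxᵢ}e_{dxⱼ}}` for every torus -/

/-- **Under `𝔤_tot(X; ℚ)₂ ≅ H²(X; ℚ)` the generator `e_{dxᵢ}e_{dxⱼ}` of row A1-75 goes to the lattice monomial `dxᵢ ∧ dxⱼ =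
latMonomial Φ 2 ![i, j]` of row A4-24.** [cite: LooijengaLunts1997, §2 (2.8), §3 (3.1)–(3.3)] [cite: Lange2023AbelianVarietiesComplex, §1.1.3 Cor. 1.1.19] -/
theorem degTwoEquivRationalForms_extR_mul_extR (i j : ι) :
    ((degTwoEquivRationalForms Φ ⟨extR (latticeDx Φ i) * extR (latticeDx Φ j),
        extR_mul_extR_latticeDx_mem_totalLieAlgebraRatDeg_two Φ i j⟩ : rationalForms Φ 2) : E [⋀^Fin 2]→L[ℝ] ℂ) =
      latMonomial Φ 2 ![i, j] := by
  change (extR (latticeDx Φ i) * extR (latticeDx Φ j)) (of 0 (oneForm₀ E)) 2 = _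
  rw [extR_mul_extR_eq_lefschetzG_pairForm, lefschetzG_apply_oneForm₀_two, ofRealForm_pairForm_latticeDx_eq_latMonomial]

omit [Nontrivial E] in
/-- `e_{Re γ} ∈ span_ℚ {e_{dxᵢ}e_{dxⱼ}}` for every `γ ∈ H²(X; ℚ)` (`γ ↦ e_{Re γ}` is `ℚ`-linear and `H²(X; ℚ) = span_ℚ {dxᵢ ∧ dxⱼ}`).
[cite: LooijengaLunts1997, §3 (3.1)–(3.3)] [cite: Lange2023AbelianVarietiesComplex, §1.1.3 Cor. 1.1.19] -/
theorem lefschetzG_reForm_mem_span_extR_mul_extR [DecidableEq ι] {γ : E [⋀^Fin 2]→L[ℝ] ℂ}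
    (hγ : γ ∈ rationalForms Φ 2) :
    lefschetzG (reForm γ) ∈ Submodule.span ℚ
      {T : Module.End ℂ (GForm E ℂ) | ∃ i j : ι, T = extR (latticeDx Φ i) * extR (latticeDx Φ j)} := by
  rw [rationalForms_two_eq_span_pairForm Φ] at hγ
  refine Submodule.span_induction (p := fun γ _ ↦ lefschetzG (reForm γ) ∈ Submodule.span ℚ
      {T : Module.End ℂ (GForm E ℂ) | ∃ i j : ι, T = extR (latticeDx Φ i) * extR (latticeDx Φ j)}) ?_ ?_ ?_ ?_ hγ
  · rintro _ ⟨i, j, rfl⟩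
    rw [reForm_ofRealForm, ← extR_mul_extR_eq_lefschetzG_pairForm]
    exact Submodule.subset_span ⟨i, j, rfl⟩
  · rw [reForm_zero, lefschetzG_zero]; exact Submodule.zero_mem _
  · intro γ δ _ _ hγ hδ
    rw [reForm_add, lefschetzG_add_aux]; exact Submodule.add_mem _ hγ hδ
  · intro q γ _ hγ
    rw [reForm_rat_smul, lefschetzG_smul, Rat.cast_smul_eq_qsmul]; exact Submodule.smul_mem _ _ hγ

/-- **`𝔤_tot(X; ℚ)₂ = span_ℚ {e_{dxᵢ} e_{dxⱼ}}` FOR EVERY COMPLEX TORUS** (row A1-75's `totalLieAlgebraRatDeg_two_eq_span` without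
its hypothesis `g ≥ 2`: here through `𝔤₂(ℚ) = e(H²(X; ℚ))` and `H²(X; ℚ) = span_ℚ {dxᵢ ∧ dxⱼ}`; "`ψ₂ : ⋀²V^* → 𝔰𝔬(V ⊕ V^*)₂`,
`α ∧ β ↦ e_αe_β`" on the rational structure). [cite: LooijengaLunts1997, §3 (3.1)–(3.3)] -/
theorem totalLieAlgebraRatDeg_two_eq_span_extR_mul_extR [DecidableEq ι] : totalLieAlgebraRatDeg Φ 2 =
    Submodule.span ℚ {T : Module.End ℂ (GForm E ℂ) | ∃ i j : ι, T = extR (latticeDx Φ i) * extR (latticeDx Φ j)} := by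
  refine le_antisymm (fun T hT ↦ ?_) (Submodule.span_le.2 ?_)
  · rw [eq_lefschetzG_reForm_of_mem_totalLieAlgebraRatDeg_two Φ hT]
    exact lefschetzG_reForm_mem_span_extR_mul_extR Φ (apply_oneForm₀_mem_rationalForms Φ hT.1 2)
  · rintro _ ⟨i, j, rfl⟩
    exact extR_mul_extR_latticeDx_mem_totalLieAlgebraRatDeg_two Φ i j

end LefschetzRat

/-! ### §6 Validation (Layer-A referee): an abelian surface and an elliptic curve -/

section Validation

variable {ι : Type*} [Fintype ι]

/-- **VALIDATION (abelian SURFACE `X = ℂ²/Φ(ℤ^ι)`): `dim_ℚ 𝔤_tot(X; ℚ)₂ = 6 = dim_ℚ H²(X; ℚ)`** (`C(4, 2) = 6`; row A1-75's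
`finrank_totalLieAlgebraRatDeg_finTwo` by the `𝔰𝔬₄(ℚ)`-route gives the same `6`). [cite: LooijengaLunts1997, §2 (2.8), §3 (3.3)] -/
theorem finrank_totalLieAlgebraRatDeg_two_finTwo (Φ : (ι → ℝ) ≃L[ℝ] (Fin 2 → ℂ)) :
    finrank ℚ (totalLieAlgebraRatDeg Φ 2) = 6 ∧ finrank ℚ (rationalForms Φ 2) = 6 := by
  refine ⟨?_, ?_⟩
  · rw [finrank_totalLieAlgebraRatDeg_two_eq_choose, Module.finrank_fin_fun]; rfl
  · rw [← finrank_totalLieAlgebraRatDeg_two_eq_finrank_rationalForms, finrank_totalLieAlgebraRatDeg_two_eq_choose,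
      Module.finrank_fin_fun]; rfl

/-- **VALIDATION (ELLIPTIC CURVE `X = ℂ/Φ(ℤ^ι)`, the case `g = 1` outside row A1-75): `dim_ℚ 𝔤_tot(X; ℚ)₂ = 1 = dim_ℚ H²(X; ℚ)`**
(`C(2, 2) = 1`: `𝔤_tot(X; ℚ) ≅ 𝔰𝔩₂(ℚ)` with `𝔤₂ = ℚ·e_ω`). [cite: LooijengaLunts1997, §2 (2.8), §3 (3.3)] -/
theorem finrank_totalLieAlgebraRatDeg_two_finOne (Φ : (ι → ℝ) ≃L[ℝ] (Fin 1 → ℂ)) :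
    finrank ℚ (totalLieAlgebraRatDeg Φ 2) = 1 ∧ finrank ℚ (rationalForms Φ 2) = 1 := by
  refine ⟨?_, ?_⟩
  · rw [finrank_totalLieAlgebraRatDeg_two_eq_choose, Module.finrank_fin_fun]; rfl
  · rw [← finrank_totalLieAlgebraRatDeg_two_eq_finrank_rationalForms, finrank_totalLieAlgebraRatDeg_two_eq_choose,
      Module.finrank_fin_fun]; rfl

end Validation

end ComplexTorus

end Literature.Geometry.Kaehler
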